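/-
Copyright: lit-balaban cell, Phase-2 proof seat p11 (gen 4).  Statement-level skeleton of a published paper; no proof claims beyond
what the kernel checks below.
-/
import Literature.MathematicalPhysics.QuantumFieldTheory.BalabanImbrieJaffe1984to88.BIJ85BlockAveragesTorusK
import Literature.MathematicalPhysics.QuantumFieldTheory.Balaban1983to89.LatticeFieldCalculus

/-!
# `BalabanImbrieJaffe1984to88.BIJ85BlockAveragingIneq` — T. Bałaban, J. Imbrie, A. Jaffe, *Renormalization of the Higgs model:
minimizers, propagators and the stability of mean field theory*, Commun. Math. Phys. **97** (1985) 299–329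
[BalabanImbrieJaffe1985]: the torus geometry behind Sect. 7.3 — **the block-averaging inequality at level `k`**: the unit-lattice
bond form of a `k`-fold block average (2.6)/(4.6.2) is bounded by `(n²/N)·`(the fine kinetic form), `n = L^k`, `N = L^{kd}`; theorems only.

statement-level skeleton of published theorems with citation tags; proofs where landed; nothing here is a claim about the Yang–Mills mass gap

PDF held: `paper:balaban1985-cmp97-bij-higgs-minimizers` (journal page = PDF page + 298).  Pages read this session: p. 302–303 [PDF 4–5],
p. 313 [PDF 15], p. 326 [PDF 28].

CITATION HEADER (lean-in-tree rule).  Phase-2 file of the lit-balaban TYPED SKELETON (HOME `run/shared/lean/pub/lit-balaban/`), seat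
p11 gen 4 (unit `lit-balaban-p11-g4`; TAKING line HOME/STATUS.md 2026-08-21T06:04:48Z; owner r15, referee ref-5): the geometric half
(file 1/2) of the flat-background member of SKELETON row **C1.Eq7.3.1-7.3.2**; the stability estimate (7.3.2) itself is the sibling
`BIJ85Ineq732Flat` (file 2/2).  Carriers of record only (`Balaban1983to89.Site P j`, `PBond`, `GaugeField P j U1`, r18's
`BIJ85BlockAveragesTorus` runs/corners and gen 3's `BIJ85BlockAveragesTorusK` iterated blocks `blockK`/`blkIter`, `k`-level average
`qCovK`, iterates `lineIter` — BY NAME, nothing re-declared).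

THE PRINTED TEXT, verbatim.  p. 303 [PDF 5]: *"(Qφ)_y = L^{−d} Σ_{x∈B(y)} u(Γ_{yx})φ_x. (2.6) … In the axial gauge, Qφ reduces to the
ordinary average of φ"*; p. 309 [PDF 11]: *"Q_k is the k-fold composition of the 1-step averaging operators"*; p. 326 [PDF 28]:
*"⟨φ, Δ_k(u_k)φ⟩ ≥ γ Σ_{b∈T₁^{(k)}} |u_k(b)φ(b₊) − φ(b₋)|² − Me_k^{2−α} Σ_{x∈T₁^{(k)}} |φ(x)|². (7.3.2) … These inequalities can be
proved by an extension of the proofs of [7]."* ([7] = B4 [Balaban1983RegularityDecay]; the block-averaging inequality is the step of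
its Prop. 3.1′ proof that `Balaban1983to89/B4Prop31Zero` §4 isolates at `A = 0` on regions of `ℤ^{d+1}` — *"The torus variant is
not typed here"*; this file is the torus / level-`k` variant on the series' carriers, proved independently.)

WHAT IS PROVED (0 `sorry`, standard axioms; no `def`).
* §1 sums over bonds / shifted sites of the torus (`sum_bond_eq`, `sum_shift_eq`, `sum_sum_dir`, `sum_sum_shift_dir`, `shift_inj`).
* §2 **the translation `x ↦ x + L^ke_μ` of the `η`-lattice maps `B^k(y)` onto `B^k(y + e_μ)`** (`blkIter_translate`: `(x + L^ke_μ)_k =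
  x_k + e_μ`, induction on `k` from r18's `blockOf_runSite_L`; `sum_blockK_shift`; `sum_blockK_sum`: the blocks partition the torus).
* §3 the flat background: all iterates `u^{(i)} = 1` (`lineIter_one`), so `Q_k(1)` is the plain block average (`qCovK_one_apply`).
* §4 **`sum_norm_qCovK_one_shift_sub_sq_le`**: for every `φ : T_η → ℂ` and `j + k ≤ m + K`,
  `Σ_{y∈T₁^{(k)}} Σ_μ |(Q_k(1)φ)(y + e_μ) − (Q_k(1)φ)(y)|² ≤ (n²/N)·Σ_{b⊂T_η} |φ(b₊) − φ(b₋)|²` — Jensen over the `N` points of a block,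
  telescoping along the straight run of `n` fine bonds + Cauchy–Schwarz (`norm_sub_sq_le_run`), and the translation bijection per step
  (`sum_blocks_runs`: every fine bond serves exactly `n` (point, step) pairs).
* §5 (abstract inner-product spaces) the value of the printed form (4.6.4) at its minimizer `ψ_k = a_kG_kQ_k^*ψ`:
  `⟨ψ, Δ_kψ⟩ = a_k‖Q_kψ_k − ψ‖² + ‖Dψ_k‖²` (twice gen 2's `BIJ85ScalarForm464.scalarForm_phiCl`), whence `0 ≤ ⟨ψ, Δ_k(u_k)ψ⟩ ≤ a_k‖ψ‖²`
  for EVERY background; §6 the printed `a_k = a(1 − L^{−2})(1 − L^{−2k})^{−1} ≥ a(1 − L^{−2}) ≥ 8a/9` (`L ≥ 3`, `k ≥ 1`).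
Honest scope: flat background only; at a general `u` the same computation produces holonomy defects around the closed contours
`Γ^{(k)}_{yx} ∘ ⟨x, x+L^ke_μ⟩ ∘ …` (not treated; see `BIJ85Ineq732Flat`, HONEST SCOPE).
-/

open scoped RealInnerProductSpace BigOperators
open Finset

namespace Literature.MathematicalPhysics.QuantumFieldTheory.BalabanImbrieJaffe1984to88.BIJ85BlockAveragingIneq

open Literature.MathematicalPhysics.QuantumFieldTheory.Balaban1983to89
open BIJ88Sect3Statements (U1 toC toC_one)
open BIJ85Sect1Model (HiggsField)
open BIJ88RenormTransf311 (DeltaAx)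
open BIJ85BlockAveragesTorus BIJ85BlockAveragesTorusK
open BIJ85ScalarForm464 BIJ85Eq461Proof
open LatticeFieldCalculus (shiftEquiv)

noncomputable section

variable {P : Params} {j : ℕ}

/-! ## §1 Sums over the bonds and the shifted sites of a torus -/

/-- kernel: a sum over the (positively oriented) bonds of the torus `T^{(i)}` — the `Σ_b` of the bond inner product (2.14) and of (7.3.2) —
is the double sum over initial points and directions (`LatticeFieldCalculus.bondEquiv`). [cite: BalabanImbrieJaffe1985, (2.14) p.304] -/
theorem sum_bond_eq {i : ℕ} {α : Type*} [AddCommMonoid α] (F : PBond P i → α) :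
    ∑ b : PBond P i, F b = ∑ x : Balaban1983to89.Site P i, ∑ μ : Fin P.d, F ⟨x, μ⟩ :=
  calc ∑ b : PBond P i, F b = ∑ p : Balaban1983to89.Site P i × Fin P.d, F (LatticeFieldCalculus.bondEquiv p) :=
        (Equiv.sum_comp (LatticeFieldCalculus.bondEquiv (P := P) (j := i)) F).symm
    _ = ∑ x : Balaban1983to89.Site P i, ∑ μ : Fin P.d, F ⟨x, μ⟩ := Fintype.sum_prod_type _

/-- `x ↦ x + e_μ` is a permutation of the torus (`LatticeFieldCalculus.shiftEquiv`): sums are invariant. [folklore] -/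
private theorem sum_shift_eq {i : ℕ} {α : Type*} [AddCommMonoid α] (μ : Fin P.d) (F : Balaban1983to89.Site P i → α) :
    ∑ x : Balaban1983to89.Site P i, F (x.shift μ) = ∑ x : Balaban1983to89.Site P i, F x :=
  Equiv.sum_comp (shiftEquiv (P := P) (j := i) μ) F

/-- kernel: `Σ_{x∈T} Σ_μ F(x) = d·Σ_{x∈T} F(x)` for sums over the torus sites (the `Σ_{x∈T_a}` of (2.2)). [cite: BalabanImbrieJaffe1985, (2.2) p.302] -/
theorem sum_sum_dir {i : ℕ} (F : Balaban1983to89.Site P i → ℝ) :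
    ∑ x : Balaban1983to89.Site P i, ∑ _μ : Fin P.d, F x = P.d * ∑ x : Balaban1983to89.Site P i, F x := by
  rw [mul_sum]
  refine sum_congr rfl fun x _ => ?_
  rw [sum_const, card_univ, Fintype.card_fin, nsmul_eq_mul]

/-- kernel: `Σ_{x∈T} Σ_μ F(x + e_μ) = d·Σ_{x∈T} F(x)` — periodic (toroidal) boundary conditions (2.2)–(2.3): each shift permutes the sites.
[cite: BalabanImbrieJaffe1985, (2.2) p.302] -/
theorem sum_sum_shift_dir {i : ℕ} (F : Balaban1983to89.Site P i → ℝ) :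
    ∑ x : Balaban1983to89.Site P i, ∑ μ : Fin P.d, F (x.shift μ) = P.d * ∑ x : Balaban1983to89.Site P i, F x := by
  rw [sum_comm, sum_congr rfl fun μ _ => sum_shift_eq μ F, sum_const, card_univ, Fintype.card_fin, nsmul_eq_mul]

/-! ## §2 Torus geometry at level `k`: the translation by `L^k` fine steps maps `B^k(y)` onto `B^k(y + e_μ)` -/

/-- kernel: runs compose, `x + (s+t)e_μ = (x + se_μ) + te_μ` (r18's `runSite`). [cite: BalabanImbrieJaffe1985, (2.10) p.303] -/
theorem runSite_add {i : ℕ} (x : Balaban1983to89.Site P i) (μ : Fin P.d) (s t : ℕ) :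
    runSite x μ (s + t) = runSite (runSite x μ s) μ t := by
  funext κ
  by_cases hκ : κ = μ
  · subst hκ
    simp only [runSite, Function.update_self]
    push_cast
    ring
  · simp only [runSite, Function.update_of_ne hκ]

/-- kernel: one step of a run is the shift `x + e_μ`. [cite: BalabanImbrieJaffe1985, (2.10) p.303] -/
theorem runSite_one {i : ℕ} (x : Balaban1983to89.Site P i) (μ : Fin P.d) : runSite x μ 1 = x.shift μ := by
  rw [← runSite_shift x μ 0, runSite_zero]

/-- The translation `x ↦ x + ne_μ` of the torus is injective. [folklore] -/
private theorem runSite_injective {i : ℕ} (μ : Fin P.d) (n : ℕ) :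
    Function.Injective fun x : Balaban1983to89.Site P i => runSite x μ n := by
  intro x y h
  funext κ
  have hκ := congrFun h κ
  by_cases e : κ = μ
  · subst e
    simpa only [runSite, Function.update_self, add_left_inj] using hκ
  · simpa only [runSite, Function.update_of_ne e] using hκ

/-- The translation `x ↦ x + ne_μ` of the (finite) torus is bijective. [folklore] -/
private theorem runSite_bijective {i : ℕ} (μ : Fin P.d) (n : ℕ) :
    Function.Bijective fun x : Balaban1983to89.Site P i => runSite x μ n :=
  Finite.injective_iff_bijective.1 (runSite_injective μ n)

/-- Sums over the torus are invariant under the translation `x ↦ x + ne_μ`. [folklore] -/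
private theorem sum_runSite_eq {i : ℕ} {α : Type*} [AddCommMonoid α] (μ : Fin P.d) (n : ℕ) (F : Balaban1983to89.Site P i → α) :
    ∑ x : Balaban1983to89.Site P i, F (runSite x μ n) = ∑ x : Balaban1983to89.Site P i, F x :=
  Fintype.sum_bijective _ (runSite_bijective μ n) _ _ fun _ => rfl

/-- kernel: `blockOf (x + sLe_μ) = blockOf x + se_μ` — translating by `s` blocks moves the block label by `s` (r18's
`blockOf_runSite_L` iterated; standing range). [cite: BalabanImbrieJaffe1985, (2.4) p.302] -/
theorem blockOf_runSite_mul {i : ℕ} (hi : i + 1 ≤ P.m + P.K) (x : Balaban1983to89.Site P i) (μ : Fin P.d) :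
    ∀ s : ℕ, blockOf (runSite x μ (P.L * s)) = runSite (blockOf x) μ s
  | 0 => by rw [mul_zero, runSite_zero, runSite_zero]
  | s + 1 => by
    rw [mul_add, mul_one, runSite_add, blockOf_runSite_L hi, blockOf_runSite_mul hi x μ s, runSite_shift]

/-- kernel: `(x + sL^ke_μ)_k = x_k + se_μ` for the `k`-fold block point (5.1.2) (induction on `k`; standing range).
[cite: BalabanImbrieJaffe1985, (5.1.2)–(5.1.3) p.313] -/
theorem blkIter_runSite (μ : Fin P.d) :
    ∀ (k : ℕ), j + k ≤ P.m + P.K → ∀ (x : Balaban1983to89.Site P j) (s : ℕ),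
      blkIter k (runSite x μ (P.L ^ k * s)) = runSite (blkIter k x) μ s
  | 0, _, x, s => by rw [pow_zero, one_mul]; rfl
  | k + 1, hk, x, s => by
    rw [blkIter_succ, pow_succ, mul_assoc, blkIter_runSite μ k (by omega) x (P.L * s),
      blockOf_runSite_mul (by omega), blkIter_succ]

/-- **The translation by `L^k` fine steps maps `B^k(y)` into `B^k(y + e_μ)`**: `(x + L^ke_μ)_k = x_k + e_μ` (standing range).
[cite: BalabanImbrieJaffe1985, (5.1.2)–(5.1.3) p.313] -/
theorem blkIter_translate {k : ℕ} (hk : j + k ≤ P.m + P.K) (x : Balaban1983to89.Site P j) (μ : Fin P.d) :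
    blkIter k (runSite x μ (P.L ^ k)) = (blkIter k x).shift μ := by
  have h := blkIter_runSite μ k hk x 1
  rwa [mul_one, runSite_one] at h

/-- `x + e_μ = y + e_μ ↔ x = y` on the torus. [folklore] -/
private theorem shift_inj {i : ℕ} {x y : Balaban1983to89.Site P i} {μ : Fin P.d} : x.shift μ = y.shift μ ↔ x = y :=
  (shiftEquiv (P := P) (j := i) μ).injective.eq_iff

/-- **`Σ_{x′∈B^k(y+e_μ)} F(x′) = Σ_{x∈B^k(y)} F(x + L^ke_μ)`** — the translation is a bijection of the torus carrying `B^k(y)` onto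
`B^k(y + e_μ)` (standing range). [cite: BalabanImbrieJaffe1985, (5.1.2)–(5.1.3) p.313] -/
theorem sum_blockK_shift {k : ℕ} (hk : j + k ≤ P.m + P.K) {α : Type*} [AddCommMonoid α] (F : Balaban1983to89.Site P j → α)
    (y : Balaban1983to89.Site P (j+k)) (μ : Fin P.d) :
    ∑ x ∈ blockK k (y.shift μ), F x = ∑ x ∈ blockK k y, F (runSite x μ (P.L ^ k)) := by
  rw [blockK, blockK, sum_filter, sum_filter]
  symm
  refine Fintype.sum_bijective _ (runSite_bijective μ (P.L ^ k)) _ _ fun x => ?_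
  simp only [blkIter_translate hk, shift_inj]

/-- kernel: the iterated blocks partition the `η`-lattice: `Σ_{y∈T₁^{(k)}} Σ_{x∈B^k(y)} F(x) = Σ_{x∈T_η} F(x)`.
[cite: BalabanImbrieJaffe1985, (5.1.2)–(5.1.3) p.313] -/
theorem sum_blockK_sum {k : ℕ} {α : Type*} [AddCommMonoid α] (F : Balaban1983to89.Site P j → α) :
    ∑ y : Balaban1983to89.Site P (j+k), ∑ x ∈ blockK k y, F x = ∑ x : Balaban1983to89.Site P j, F x := by
  simp only [blockK]
  exact sum_fiberwise univ (blkIter k) F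

/-! ## §3 The flat background `u = 1`: iterates, `Q_k(1)`, `D₁` -/

/-- kernel: at the flat background the run transports (2.5) are `1`. [cite: BalabanImbrieJaffe1985, (2.5) p.302] -/
theorem runProd_one (x : Balaban1983to89.Site P j) (μ : Fin P.d) : ∀ n : ℕ, runProd (1 : GaugeField P j U1) x μ n = 1
  | 0 => rfl
  | n + 1 => by rw [runProd, runProd_one x μ n, one_mul]; rfl

/-- kernel: at the flat background `u(Γ_{yy′}) = 1` for every `L`-lattice bond. [cite: BalabanImbrieJaffe1985, (2.5) p.302] -/
theorem lineU_one : lineU (1 : GaugeField P j U1) = 1 := funext fun _ => runProd_one _ _ _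

/-- kernel: every iterate `u^{(i)}` of the flat background is flat, `lineIter 1 i = 1`. [cite: BalabanImbrieJaffe1985, (5.1.2)–(5.1.3) p.313] -/
theorem lineIter_one : ∀ k : ℕ, lineIter (1 : GaugeField P j U1) k = 1
  | 0 => rfl
  | k + 1 => by rw [lineIter_succ, lineIter_one k, lineU_one]

/-- kernel: the flat background is in axial gauge (r18's `DeltaAx`). [cite: BalabanImbrieJaffe1985, (2.6) p.303] -/
theorem deltaAx_one {i : ℕ} : DeltaAx (1 : GaugeField P i U1) := fun _ _ => rfl

/-- **`Q_k(1)` is the plain block average**: `(Q_k(1)φ)(y) = L^{−kd}Σ_{x∈B^k(y)} φ(x)` (p. 303 *"In the axial gauge, Qφ reduces to the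
ordinary average of φ"*, at level `k`: gen 3's `qCovK_of_deltaAx`). [cite: BalabanImbrieJaffe1985, (2.6) p.303] -/
theorem qCovK_one_apply {k : ℕ} (hk : j + k ≤ P.m + P.K) (φ : HiggsField P j) (y : Balaban1983to89.Site P (j+k)) :
    qCovK (1 : GaugeField P j U1) k φ y = ((P.L : ℂ) ^ (k * P.d))⁻¹ * ∑ x ∈ blockK k y, φ x :=
  qCovK_of_deltaAx 1 hk (fun i _ => by rw [lineIter_one i]; exact deltaAx_one) φ y

/-! ## §4 The block-averaging inequality at the flat background (level `k`, torus) -/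

/-- Jensen / Cauchy–Schwarz on a finite set: `|Σ_{x∈S} a_x|² ≤ |S|·Σ_{x∈S}|a_x|²`. [folklore] -/
private theorem norm_sum_sq_le_card_mul {ι : Type*} (S : Finset ι) (a : ι → ℂ) :
    ‖∑ x ∈ S, a x‖ ^ 2 ≤ S.card * ∑ x ∈ S, ‖a x‖ ^ 2 :=
  calc ‖∑ x ∈ S, a x‖ ^ 2 ≤ (∑ x ∈ S, ‖a x‖) ^ 2 := pow_le_pow_left₀ (norm_nonneg _) (norm_sum_le _ _) 2
    _ ≤ S.card * ∑ x ∈ S, ‖a x‖ ^ 2 := sq_sum_le_card_mul_sum_sq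

/-- kernel: TELESCOPING along the straight run of `n` bonds from `x` in direction `μ`, then Cauchy–Schwarz:
`|φ(x + ne_μ) − φ(x)|² ≤ n·Σ_{t<n} |φ(x + (t+1)e_μ) − φ(x + te_μ)|²`. [cite: BalabanImbrieJaffe1985, (2.10) p.303] -/
theorem norm_sub_sq_le_run (φ : Balaban1983to89.Site P j → ℂ) (x : Balaban1983to89.Site P j) (μ : Fin P.d) (n : ℕ) :
    ‖φ (runSite x μ n) - φ x‖ ^ 2
      ≤ n * ∑ t ∈ range n, ‖φ ((runSite x μ t).shift μ) - φ (runSite x μ t)‖ ^ 2 := by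
  have tel : φ (runSite x μ n) - φ x = ∑ t ∈ range n, (φ ((runSite x μ t).shift μ) - φ (runSite x μ t)) := by
    simp_rw [runSite_shift]
    rw [Finset.sum_range_sub (fun t => φ (runSite x μ t)), runSite_zero]
  rw [tel]
  have h := norm_sum_sq_le_card_mul (range n) (fun t => φ ((runSite x μ t).shift μ) - φ (runSite x μ t))
  rwa [card_range] at h

/-- kernel (one unit bond): `|(Q_k(1)φ)(y + e_μ) − (Q_k(1)φ)(y)|² ≤ N^{−1}·n·Σ_{x∈B^k(y)} Σ_{t<n} |φ(x + (t+1)e_μ) − φ(x + te_μ)|²`,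
`n = L^k`, `N = L^{kd}`: the difference of the two block averages is the block average of `φ(x + ne_μ) − φ(x)` (`sum_blockK_shift`),
Jensen over the `N` points of the block, telescoping + Cauchy–Schwarz along each run (standing range). [cite: BalabanImbrieJaffe1985, (7.3.2) p.326] -/
theorem norm_qCovK_one_shift_sub_sq_le {k : ℕ} (hk : j + k ≤ P.m + P.K) (φ : HiggsField P j)
    (y : Balaban1983to89.Site P (j+k)) (μ : Fin P.d) :
    ‖qCovK (1 : GaugeField P j U1) k φ (y.shift μ) - qCovK (1 : GaugeField P j U1) k φ y‖ ^ 2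
      ≤ ((P.L : ℝ) ^ (k * P.d))⁻¹ * (P.L ^ k : ℕ) *
          ∑ x ∈ blockK k y, ∑ t ∈ range (P.L ^ k), ‖φ ((runSite x μ t).shift μ) - φ (runSite x μ t)‖ ^ 2 := by
  have hN : (0 : ℝ) < (P.L : ℝ) ^ (k * P.d) := pow_pos (Nat.cast_pos.2 P.L_pos) _
  rw [qCovK_one_apply hk, qCovK_one_apply hk, sum_blockK_shift hk, ← mul_sub, ← sum_sub_distrib, norm_mul, mul_pow,
    norm_inv, norm_pow, Complex.norm_natCast]
  have h1 := norm_sum_sq_le_card_mul (blockK k y) (fun x => φ (runSite x μ (P.L ^ k)) - φ x)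
  rw [card_blockK k hk y, Nat.cast_pow] at h1
  have h2 : ∑ x ∈ blockK k y, ‖φ (runSite x μ (P.L ^ k)) - φ x‖ ^ 2
      ≤ ∑ x ∈ blockK k y, ((P.L ^ k : ℕ) : ℝ) *
          ∑ t ∈ range (P.L ^ k), ‖φ ((runSite x μ t).shift μ) - φ (runSite x μ t)‖ ^ 2 :=
    sum_le_sum fun x _ => norm_sub_sq_le_run φ x μ (P.L ^ k)
  rw [← mul_sum] at h2
  calc ((P.L : ℝ) ^ (k * P.d))⁻¹ ^ 2 * ‖∑ x ∈ blockK k y, (φ (runSite x μ (P.L ^ k)) - φ x)‖ ^ 2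
      ≤ ((P.L : ℝ) ^ (k * P.d))⁻¹ ^ 2 * ((P.L : ℝ) ^ (k * P.d) * (((P.L ^ k : ℕ) : ℝ) *
          ∑ x ∈ blockK k y, ∑ t ∈ range (P.L ^ k), ‖φ ((runSite x μ t).shift μ) - φ (runSite x μ t)‖ ^ 2)) :=
        mul_le_mul_of_nonneg_left (h1.trans (mul_le_mul_of_nonneg_left h2 hN.le)) (by positivity)
    _ = _ := by field_simp

/-- kernel (counting): `Σ_y Σ_μ Σ_{x∈B^k(y)} Σ_{t<n} F_μ(x + te_μ) = n·Σ_x Σ_μ F_μ(x)` — blocks partition the torus and for each `t` the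
translation `x ↦ x + te_μ` is a bijection (so every fine bond serves exactly `n` (point, step) pairs). [folklore] -/
private theorem sum_blocks_runs {k : ℕ} (n : ℕ) (F : Fin P.d → Balaban1983to89.Site P j → ℝ) :
    ∑ y : Balaban1983to89.Site P (j+k), ∑ μ : Fin P.d, ∑ x ∈ blockK k y, ∑ t ∈ range n, F μ (runSite x μ t)
      = n * ∑ x : Balaban1983to89.Site P j, ∑ μ : Fin P.d, F μ x := by
  rw [sum_comm, sum_comm (s := (univ : Finset (Balaban1983to89.Site P j))), mul_sum]
  refine sum_congr rfl fun μ _ => ?_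
  rw [sum_blockK_sum (k := k) (fun x => ∑ t ∈ range n, F μ (runSite x μ t)), sum_comm,
    sum_congr rfl fun t _ => sum_runSite_eq μ t (F μ), sum_const, card_range, nsmul_eq_mul]

/-- **THE BLOCK-AVERAGING INEQUALITY at the flat background, level `k`**: for every `η`-lattice field `φ`,
`Σ_{⟨y,y+e_μ⟩⊂T₁^{(k)}} |(Q_k(1)φ)(y + e_μ) − (Q_k(1)φ)(y)|² ≤ (n²/N)·Σ_{b⊂T_η} |φ(b₊) − φ(b₋)|²`, `n = L^k`, `N = L^{kd}` (standing
range) — the unit-lattice bond form of a block-averaged field is controlled by the fine kinetic form (the torus / level-`k` twin of the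
averaging inequality of `Balaban1983to89/B4Prop31Zero` §4, used by (7.3.2) at the flat background in `BIJ85Ineq732Flat`).
[cite: BalabanImbrieJaffe1985, (7.3.2) p.326] -/
theorem sum_norm_qCovK_one_shift_sub_sq_le {k : ℕ} (hk : j + k ≤ P.m + P.K) (φ : HiggsField P j) :
    ∑ y : Balaban1983to89.Site P (j+k), ∑ μ : Fin P.d,
        ‖qCovK (1 : GaugeField P j U1) k φ (y.shift μ) - qCovK (1 : GaugeField P j U1) k φ y‖ ^ 2
      ≤ ((P.L : ℝ) ^ k) ^ 2 / (P.L : ℝ) ^ (k * P.d) * ∑ b : PBond P j, ‖φ b.tgt - φ b.src‖ ^ 2 := by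
  have key := sum_blocks_runs (k := k) (P.L ^ k) (fun μ z => ‖φ (z.shift μ) - φ z‖ ^ 2)
  calc ∑ y : Balaban1983to89.Site P (j+k), ∑ μ : Fin P.d,
          ‖qCovK (1 : GaugeField P j U1) k φ (y.shift μ) - qCovK (1 : GaugeField P j U1) k φ y‖ ^ 2
      ≤ ∑ y : Balaban1983to89.Site P (j+k), ∑ μ : Fin P.d,
          ((P.L : ℝ) ^ (k * P.d))⁻¹ * (P.L ^ k : ℕ) *
            ∑ x ∈ blockK k y, ∑ t ∈ range (P.L ^ k), ‖φ ((runSite x μ t).shift μ) - φ (runSite x μ t)‖ ^ 2 :=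
        sum_le_sum fun y _ => sum_le_sum fun μ _ => norm_qCovK_one_shift_sub_sq_le hk φ y μ
    _ = ((P.L : ℝ) ^ (k * P.d))⁻¹ * (P.L ^ k : ℕ) *
          ((P.L ^ k : ℕ) * ∑ x : Balaban1983to89.Site P j, ∑ μ : Fin P.d, ‖φ (x.shift μ) - φ x‖ ^ 2) := by
        rw [← key]
        simp_rw [mul_sum]
    _ = _ := by
        rw [sum_bond_eq]
        push_cast
        have hL : (P.L : ℝ) ≠ 0 := Nat.cast_ne_zero.2 P.L_pos.ne'
        field_simp
        rfl

/-! ## §5 The value of the printed form (4.6.4) at its minimizer: `⟨ψ, Δ_kψ⟩ = a‖Q_kφ_k − ψ‖² + ‖Dφ_k‖²`, `0 ≤ Δ_k ≤ a_k` -/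

section Abstract

variable {Φ Ψ Φ₁ : Type*} [NormedAddCommGroup Φ] [InnerProductSpace ℝ Φ] [NormedAddCommGroup Ψ] [InnerProductSpace ℝ Ψ]
  [NormedAddCommGroup Φ₁] [InnerProductSpace ℝ Φ₁] [FiniteDimensional ℝ Φ] [FiniteDimensional ℝ Ψ]
  [FiniteDimensional ℝ Φ₁]
variable {D : Φ →ₗ[ℝ] Ψ} {Q : Φ →ₗ[ℝ] Φ₁} {a : ℝ}

/-- **The value of the printed form (4.6.4) at its minimizer**: `⟨ψ, Δ_kψ⟩ = a_k‖Q_kφ_k − ψ‖² + ‖Dφ_k‖²` with `φ_k = ψ_k = a_kG_kQ_k^*ψ`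
(twice gen 2's `BIJ85ScalarForm464.scalarForm_phiCl`; any right inverse `G_k` of `D^*D + a_kQ_k^*Q_k`, abstract inner-product spaces).
[cite: BalabanImbrieJaffe1985, (4.6.4) p.313] -/
theorem inner_deltaOp_eq {G : Φ →ₗ[ℝ] Φ} (hG : ∀ φ, opT D Q a (G φ) = φ) (ψ : Φ₁) :
    ⟪ψ, deltaOp Q a G ψ⟫ = a * ‖Q (phiCl Q a G ψ) - ψ‖ ^ 2 + ‖D (phiCl Q a G ψ)‖ ^ 2 := by
  have h := scalarForm_phiCl (D := D) hG ψ
  rw [scalarForm] at h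
  linarith

/-- **`0 ≤ ⟨ψ, Δ_k(u_k)ψ⟩`** for EVERY background, `a_k ≥ 0` (the form is a minimum of non-negative quantities). [cite: BalabanImbrieJaffe1985, (4.6.4) p.313] -/
theorem inner_deltaOp_nonneg {G : Φ →ₗ[ℝ] Φ} (hG : ∀ φ, opT D Q a (G φ) = φ) (ha : 0 ≤ a) (ψ : Φ₁) :
    0 ≤ ⟪ψ, deltaOp Q a G ψ⟫ := by
  rw [inner_deltaOp_eq (D := D) hG]
  positivity

/-- **`⟨ψ, Δ_k(u_k)ψ⟩ ≤ a_k‖ψ‖²`** for EVERY background, `a_k ≥ 0` (test the infimum (4.6.4) at `φ = 0`; gen 2's `eq464_inf`).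
[cite: BalabanImbrieJaffe1985, (4.6.4) p.313] -/
theorem inner_deltaOp_le {G : Φ →ₗ[ℝ] Φ} (hG : ∀ φ, opT D Q a (G φ) = φ) (ha : 0 ≤ a) (ψ : Φ₁) :
    ⟪ψ, deltaOp Q a G ψ⟫ ≤ a * ‖ψ‖ ^ 2 := by
  have h := eq464_inf (D := D) hG ha ψ 0
  rw [scalarForm, map_zero, map_zero, zero_sub, norm_neg, norm_zero] at h
  linarith

end Abstract

/-! ## §6 The printed coefficient `a_k ≥ a(1 − L^{−2}) ≥ 8a/9` on the series' tori -/

/-- kernel: the printed coefficient is bounded below, `a(1 − L^{−2}) ≤ a_k = a(1 − L^{−2})(1 − L^{−2k})^{−1}` (`a ≥ 0`, `L > 1`, `k ≥ 1`;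
companion of gen 2's `BIJ85CoefficientAk464.aK_pos_le`: `0 < a_k ≤ a`). [cite: BalabanImbrieJaffe1985, (4.6.4) p.313] -/
theorem aK_ge {a L : ℝ} (ha : 0 ≤ a) (hL : 1 < L) {k : ℕ} (hk : 1 ≤ k) :
    a * (1 - L ^ (-(2 : ℤ))) ≤ BIJ85Sect4Statements.aK a L k := by
  rw [BIJ85Sect4Statements.aK]
  have hL0 : 0 < L := by linarith
  have h2 : L ^ (-(2 : ℤ)) < 1 := by
    rw [zpow_neg, inv_lt_one₀ (zpow_pos hL0 _)]
    exact one_lt_zpow₀ hL (by norm_num)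
  have h2k : L ^ (-(2 * (k : ℤ))) < 1 := by
    rw [zpow_neg, inv_lt_one₀ (zpow_pos hL0 _)]
    exact one_lt_zpow₀ hL (by omega)
  have h2k' : 0 < L ^ (-(2 * (k : ℤ))) := zpow_pos hL0 _
  have hx : 1 ≤ (1 - L ^ (-(2 * (k : ℤ))))⁻¹ := by
    rw [one_le_inv₀ (by linarith)]
    linarith
  have h0 : 0 ≤ a * (1 - L ^ (-(2 : ℤ))) := mul_nonneg ha (by linarith)
  calc a * (1 - L ^ (-(2 : ℤ))) = a * (1 - L ^ (-(2 : ℤ))) * 1 := (mul_one _).symm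
    _ ≤ _ := mul_le_mul_of_nonneg_left hx h0

/-- kernel: the block size of the series is `L ≥ 3` (`L` odd, `L > 1`). [cite: Balaban1987RG1, §0 p.251] -/
theorem three_le_L (P : Params) : (3 : ℝ) ≤ P.L := by
  obtain ⟨r, hr⟩ := P.hL.1
  have := P.hL.2
  exact_mod_cast (show 3 ≤ P.L by omega)

/-- kernel: on the series' tori (`L ≥ 3`) `a_k ≥ 8a/9`, uniformly in `k ≥ 1` and `L`. [cite: BalabanImbrieJaffe1985, (4.6.4) p.313] -/
theorem aK_ge_eight_ninths (P : Params) {a : ℝ} (ha : 0 ≤ a) {k : ℕ} (hk : 1 ≤ k) :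
    8 * a / 9 ≤ BIJ85Sect4Statements.aK a P.L k := by
  have hL3 := three_le_L P
  have hL : (1 : ℝ) < P.L := by linarith
  refine le_trans ?_ (aK_ge ha hL hk)
  have h9 : (P.L : ℝ) ^ (-(2 : ℤ)) ≤ 1 / 9 := by
    rw [zpow_neg, show ((P.L : ℝ) ^ (2 : ℤ)) = (P.L : ℝ) ^ 2 from zpow_ofNat _ 2, one_div]
    exact inv_anti₀ (by norm_num) (by nlinarith)
  nlinarith

end

end Literature.MathematicalPhysics.QuantumFieldTheory.BalabanImbrieJaffe1984to88.BIJ85BlockAveragingIneq
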